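import Literature.MathematicalPhysics.QuantumFieldTheory.Balaban1983to89.B9Eq360DeltaPrimeACubeY
import Literature.MathematicalPhysics.QuantumFieldTheory.Balaban1983to89.B8Ineq198MultiLevelTorusL0
import Literature.MathematicalPhysics.QuantumFieldTheory.Balaban1983to89.B9RWSums347DefiniteFacesWindow

/-!
# `Balaban1983to89.B9CubeGeometryInputs` — [Balaban1985BackgroundPropagators] Sect. C p. 408–409 / Theorem 3.4 p. 400: THE [B9] SECT. A GEOMETRY OF
# THE CUBE SEQUENCE `{Ω_n(□)}` AS A `B9.Geometry` (`geoCK i □`: sites = r05's cube blocks, `d = d_T`, the member's `η, L, M`) AND THE GEOMETRIC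
# BINDERS OF `B9Thm34SectBUniformR1.thm34_Gp_uniform` FOR IT — the distance axioms, [4] Lemma 2.1 (2.61) at every exponent `9/5000 ≤ α ≤ 1`
# with ONE door exponent (`h261`), the six p. 398 scale transfers (`hST`, `Λ(α) = L⁴`), the one-step stencil (`d₀ = 1`), the lengths `Lⁿη` —
# sub-row G-B9-LETTERS, module M5.1b-G′ (site sector), FILE 5a of seat p33's plan

statement-level skeleton of published theorems with citation tags; proofs where landed; nothing here is a claim about the Yang–Mills mass gap

CITATION HEADER (lean-in-tree rule).  B9 = T. Bałaban, *Propagators for lattice gauge theories in a background field*, Commun. Math. Phys. **99** (1985)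
389–434 [Balaban1985BackgroundPropagators] (held `paper:balaban1985-cmp99-background-propagators`; journal page = PDF page + 388): Sect. C p. 408 l. 36–44
«This sequence satisfies the conditions (2.1), (2.2) with j instead of k», p. 409 l. 1–5 «the sequence {Ω_n(□)} satisfies the assumptions of Corollary 3.6.
The operators constructed for this sequence … satisfy all the inequalities of Theorems 3.1–3.3 correspondingly»; Thm 3.4 p. 400; p. 399 l. 1–3 «the constants
… do not depend on the sequence {Ω_j}, j = 0, 1, …, k, if the conditions (2.1), (2.2) are satisfied»; p. 398 remark after (3.47) «Using Lemma 2.1 in [4] we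
may replace the factor (Lʲη)^α by (Lʲη)^β(L^{j′}η)^γ»; (3.41) p. 397.  [4] = [Balaban1984PropagatorsII] Lemma 2.1 (2.59)–(2.61) pp. 233–234, (2.2) p. 224,
(2.45)–(2.46) p. 231, (2.54) p. 233.  Rows B9.Thm3.4 × B6.Lemma2.1 (cells only; no row head changes).

WHY THIS FILE (cell lit-balaban, sub-row G-B9-LETTERS, module M5.1b-G′ booked to seat p33 g96; memo `lit-balaban-p33/COR35GP-STATEMENTS-p33.md` §2, the
census of the binders of `thm34_Gp_uniform`).  Sect. B's Theorem 3.4 engine `B9Thm34SectBUniformR1.thm34_Gp_uniform` is quantified over an abstract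
`g : B9.Geometry` with block map `blk`, and asks of it: the four distance axioms, [4] (2.61) `Ineq261 d (toB6 g Rr H) δ₀ α` for every `9/5000 ≤ α < 1`
with ONE exponent `d`, the six p. 398 scale transfers for every `9/5000 ≤ α`, and the stencil bounds `dist (blk x) (blk (x ± e_μ)) ≤ d₀`.  For the
MEMBER's letters these were discharged on `geo9K` by p21 ∕ n06-k (`B9GeoLemma21KLevelV1`, `B9RWSums347DefiniteFacesWindow`, `B9GeoInputsMultiRateKLevelV1`);
for the CUBE LETTERS `G′_□` the geometry is that of r05's cube family `cubeFamY i □` (a level-0-admitting torus family of the `…L0` lineage on the same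
torus), whose blocks `BlkCubeY i □` carry the letters of FILE 1 (`blkCubeY`, `kQCubeY`, …) and M5.1a's Theorem 3.1 (`B9Thm31CubeLocalFlat`).  THIS FILE
is the cube analogue of those member files, over N03's `geomT (cubeFamY i □)` and r05's `B8Ineq198MultiLevelTorusL0.rowSum_and_thresholdT`.

WHAT IS PROVED (1 `abbrev` `geoCK`, 3 `def`s with bodies — `RM1`, `N1`, `originY`; 0 sorry; 0 new named facts; standard axioms):
* §1 `geoCK i □ : B9.Geometry` (sites `BlkCubeY i □`, `scale = level`, `dist = d_T` of `geomT (cubeFamY i □)`, `η, L, M, k` of `kGeo i`; localisation fields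
  trivial as in N03's `geomT`), `geoCK_dist ∕ _L ∕ _eta(_pos) ∕ _M ∕ _one_le_L ∕ _len ∕ _len_pos ∕ _eta_le_len` (binders `hlen`, `hlenη`, `hη`), `geoCK_len_blkCubeY`
  (`len (blk z) = L^{lev_□ z}η`, `lev_□ z ≤ j + 1`);
* §2 ★`geoCK_dist_axioms` (binders `hdnn`, `htri`, `hrefl`, `hsym`; N03's `triangle_refl_nonneg_T`);
* §3 `RM1 i = R·L·M_h − 1`, ★`levelGap_geoCK` ((2.60) geometric: `(RM−1)·max(|n−n′|−1, 0) ≤ d_T`, from N03's `levelGapT (cubeFamY i □)` — r05 certified (2.2)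
  for the cube family as a structure field), `ineq260_geoCK`, `transferL_geoCK` (`B6Cor28.transfer_of_260`), ★`scaleTransfer_rpow_geoCK`,
  `scaleTransfer_rpow_window_geoCK`, ★★`hST_geoCK` (the binder `hST` at rate `δ₀`, `Λ(α) := (ℓ+1)⁴`, every `9/5000 ≤ α`, above `4·log L/((9/5000)δ₀) ≤ RM − 1`);
* §4 `N1`, ★`rowSum_geoCK` (r05's (2.61) with the definite constant `K261` at every rate `τ ≥ σ` above `N₁(σ) + 1 ≤ R·L·M_h`), ★★`exists_h261_geoCK` (the binder
  `h261`: ONE exponent `dB(d, ℓ, δ₀)` — n06-k's door `exists_exp_window` — with `Ineq261 dB (toB6 (geoCK i □) Rr H) δ₀ α` for all `9/5000 ≤ α ≤ 1`, every member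
  above the threshold, every cover cube, any transport letters);
* §5 `torusSupNorm_sub_tshift_unit_le_one`, `dist_blkCubeY_le_one_of_near`, ★`stencil_geoCK` (binders `hd₀B`, `hd₀F`, `hd₀0` with `d₀ = 1`);
* §6 `originY`, `geoCK_site_nonempty` (binder `[Nonempty g.Site]`; `Fintype`, `DecidableEq` by instance search — two `example`s).

PROOF.  Ours; assembly of N03's torus geometry (`B6Geom246MultiLevelTorusL0`), r05's row sums, n06-k's window arithmetic (`B9RWSums347DefiniteFacesWindow`) and
r03-lineage's `B6Cor28.transfer_of_260`, following p21 ∕ n06-k's member files line by line.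

HONEST SCOPE / NOT CLAIMED.  Bookkeeping over certified geometry; the thresholds are on `R·L·M_h` of the member (print: «for RM satisfying (2.59)»), the
exponent `dB` and the constant `(ℓ+1)⁴` are proof constants, not print's; the (2.61) constant is r05's series constant `K261`, not the printed `c₁(α)`
(refuted as typed, `B6Lemma21Counterexample`).  `geoCK`'s localisation ∕ norm fields are placeholders (never read by the consumers named).  Nothing on
`d = 4`, the continuum, reflection positivity or the mass gap; NOT a node discharge; no row head changes.

RELATED IN THE TREE, NOT DUPLICATED: `B9GeoNormsKLevelV1.geo9K` ∕ `B9SectBAllBlocksGeometryY.geoBK` (the member's geometries: sites = index bonds ∕ member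
blocks), `B9GeoLemma21KLevelV1` + `B9RWSums347DefiniteFacesWindow` (the same binders for `geo9K`), r05's `B9CubeCoarsening` (cube blocks → member blocks,
used downstream, not here).
-/

noncomputable section

namespace Literature.MathematicalPhysics.QuantumFieldTheory.Balaban1983to89.B9CubeGeometryInputs

open Literature.MathematicalPhysics.QuantumFieldTheory.Balaban1983to89
open Literature.MathematicalPhysics.QuantumFieldTheory.Balaban1983to89.B6RandomWalk (Ineq261 Triangle254)
open Literature.MathematicalPhysics.QuantumFieldTheory.Balaban1983to89.B9Thm34Ext (toB6)
open Literature.MathematicalPhysics.QuantumFieldTheory.Balaban1983to89.B9Ineq347 (ScaleTransfer)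
open Literature.MathematicalPhysics.QuantumFieldTheory.Balaban1983to89.B6Cor28 (TransferL transfer_of_260)
open Literature.MathematicalPhysics.QuantumFieldTheory.Balaban1983to89.B6KLevelCensusIndexV1 (KIdx kGeo)
open Literature.MathematicalPhysics.QuantumFieldTheory.Balaban1983to89.B6Cover236MultiLevelBlocks (cubes)
open Literature.MathematicalPhysics.QuantumFieldTheory.Balaban1983to89.B6Geom246MultiLevelTorusL0 (geomT bondT TouchT bondT_adj connectedT levelGapT
  triangle_refl_nonneg_T)
open Literature.MathematicalPhysics.QuantumFieldTheory.Balaban1983to89.B6Geom246MultiLevelBoxL0 (blkOf)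
open Literature.MathematicalPhysics.QuantumFieldTheory.Balaban1983to89.B6MultiLevelTorusOperator (tshift tshift_val_eq_translate tshift_symm_apply unitVec
  one_le_of_mem)
open Literature.MathematicalPhysics.QuantumFieldTheory.Balaban1983to89.B4TorusKernel.MultiPeriod (circAbs torusSupNorm circAbs_le_abs circAbs_add_mul)
open Literature.MathematicalPhysics.QuantumFieldTheory.Balaban1983to89.B8Ineq198MultiLevelTorusL0 (rowSum_and_thresholdT)
open Literature.MathematicalPhysics.QuantumFieldTheory.Balaban1983to89.B6Ineq261LevelGap (K261)
open Literature.MathematicalPhysics.QuantumFieldTheory.Balaban1983to89.B9RWSums347DefiniteFacesWindow (exists_exp_window scaleTransfer_congr)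
open Literature.MathematicalPhysics.QuantumFieldTheory.Balaban1983to89.B9CubeLettersOpsL0 (oddMh two_le_R cubeFamY levCubeY)
open Literature.MathematicalPhysics.QuantumFieldTheory.Balaban1983to89.B9CubeLettersBondOpsL0 (BlkCubeY)
open Literature.MathematicalPhysics.QuantumFieldTheory.Balaban1983to89.B9Eq360DeltaPrimeACubeY (blkCubeY blkCubeY_apply)
open Literature.MathematicalPhysics.QuantumFieldTheory.Balaban1983to89.B9CubeSequence408 (lev_cubeFam_le_succ)
open Literature.MathematicalPhysics.QuantumFieldTheory.Balaban1983to89.Node00 (SiteY toKT shiftY)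

variable {d ℓ : ℕ} {hd : 1 ≤ d + 1} {hL : Odd (ℓ + 1) ∧ 1 < ℓ + 1} {b₀ b₁ : ℝ}

/-! ## §1  The [B9] Sect. A geometry of the cube sequence `{Ω_n(□)}`: sites = the cube family's blocks, `d = d_T`, the member's `η, L, M` -/

section Geo

variable (i : KIdx d ℓ hd hL b₀ b₁) (c : ↥(cubes (toKT i).D.toDomains))

/-- ★ **THE [B9] SECT. A GEOMETRY OF THE CUBE SEQUENCE `{Ω_n(□)}`** (the geometry `𝔅` over which Theorem 3.4 is applied to the cube letters
`G′_□`): sites = the blocks of r05's cube family `cubeFamY i □` (`BlkCubeY`), `scale s = n(s)`, `dist = d_T` (the torus graph distance (2.46) of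
N03's `geomT (cubeFamY i □)`), and the member's `k, η = |c_f|⁻¹, L, M = L·M_h` (those of `kGeo i`); the localisation fields are trivial, as in
N03's `geomT` (only `Site ∕ scale ∕ dist ∕ eta ∕ L` are read by `thm34_Gp_uniform`, `M` by the thresholds).
[cite: Balaban1985BackgroundPropagators, p.397 («y, y′ ∈ 𝔅 = ⋃_j Λ_j»), (3.41) p.397, p.408–409 (the sequence {Ω_n(□)}); Balaban1984PropagatorsII, (2.45)–(2.46) p.231] -/
abbrev geoCK : B9.Geometry where
  Site := BlkCubeY i c
  scale := fun s => s.1.1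
  dist := fun s t => (geomT (cubeFamY i c)).dist s t
  k := (kGeo i).k
  eta := (kGeo i).eta
  L := (kGeo i).L
  M := (kGeo i).M
  Loc := Unit
  suppIn := fun _ _ => True
  suppInT := fun _ _ => True
  supNorm := fun _ => 0
  l2Norm := fun _ => 0
  wNorm := fun _ _ => 0
  holder := fun _ _ => 0
  Cut := Unit
  cutIn := fun _ _ => True
  cutInT := fun _ _ => True
  cutH := fun _ _ => 0
  cutSup := fun _ => 0
  suppInT_of_suppIn := fun _ _ h => h
  cutInT_of_cutIn := fun _ _ h => h

/-- `d(s, t)` is the torus graph distance of the cube family's blocks, cast to `ℝ`. [cite: Balaban1984PropagatorsII, (2.46) p.231, dictionary] -/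
theorem geoCK_dist (s t : BlkCubeY i c) : (geoCK i c).dist s t = ((bondT (cubeFamY i c)).dist s t : ℝ) := rfl

/-- `L = ℓ + 1`. [cite: Balaban1984PropagatorsII, (2.1) p.224, bookkeeping] -/
theorem geoCK_L : (geoCK i c).L = (ℓ : ℝ) + 1 := by
  show (((ℓ + 1 : ℕ) : ℝ)) = (ℓ : ℝ) + 1; push_cast; ring

/-- `η = |c_f|⁻¹ > 0`. [cite: Balaban1984PropagatorsII, (2.1) p.224 («η = L^{−k}»), bookkeeping] -/
theorem geoCK_eta_pos : 0 < (geoCK i c).eta := by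
  show (0 : ℝ) < |i.cf|⁻¹; exact inv_pos.mpr (abs_pos.mpr i.hcf)

/-- `η` is the member's `(kGeo i).eta`. [cite: Balaban1984PropagatorsII, (2.1) p.224, bookkeeping] -/
theorem geoCK_eta : (geoCK i c).eta = (kGeo i).eta := rfl

/-- `M = L·M_h ≥ 0`. [cite: Balaban1984PropagatorsII, (2.1) p.224, bookkeeping] -/
theorem geoCK_M : (geoCK i c).M = ((ℓ : ℝ) + 1) * (i.Mh : ℝ) := by
  show (((ℓ + 1 : ℕ) : ℝ)) * (i.Mh : ℝ) = _; push_cast; ring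

/-- `1 ≤ L`. [cite: Balaban1984PropagatorsII, (2.1) p.224, bookkeeping] -/
theorem geoCK_one_le_L : 1 ≤ (geoCK i c).L := by
  rw [geoCK_L]; linarith [(Nat.cast_nonneg ℓ : (0 : ℝ) ≤ ℓ)]

/-- the length `L^{n(s)}η` of a cube block. [cite: Balaban1985BackgroundPropagators, (3.41) p.397] -/
theorem geoCK_len (s : BlkCubeY i c) : (geoCK i c).len s = ((ℓ : ℝ) + 1) ^ s.1.1 * (kGeo i).eta := by
  show (geoCK i c).L ^ s.1.1 * (geoCK i c).eta = _; rw [geoCK_L]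

/-- `0 < L^{n}η`. [cite: Balaban1985BackgroundPropagators, (3.41) p.397, bookkeeping] -/
theorem geoCK_len_pos (s : BlkCubeY i c) : 0 < (geoCK i c).len s := by
  rw [geoCK_len]; exact mul_pos (by positivity) (geoCK_eta_pos i c)

/-- `η ≤ L^{n}η`. [cite: Balaban1985BackgroundPropagators, (3.41) p.397, bookkeeping] -/
theorem geoCK_eta_le_len (s : BlkCubeY i c) : (geoCK i c).eta ≤ (geoCK i c).len s := by
  rw [geoCK_len, geoCK_eta]
  exact le_mul_of_one_le_left (geoCK_eta_pos i c).le (one_le_pow₀ (by linarith [(Nat.cast_nonneg ℓ : (0 : ℝ) ≤ ℓ)]))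

/-- the length of the block of a site is `L^{lev_□ z}η`, `lev_□ z ≤ j + 1`: `η·L^{lev_□ z}` with `L^{lev_□ z} ≤ L^{j+1}`.
[cite: Balaban1985BackgroundPropagators, p.408 («{Ω_n(□)}_{n=0,…,j+1}»), (3.41) p.397] -/
theorem geoCK_len_blkCubeY (z : SiteY i) : (geoCK i c).len (blkCubeY i c z) = ((ℓ : ℝ) + 1) ^ levCubeY i c z * (kGeo i).eta ∧
    levCubeY i c z ≤ c.1.1 + 1 := by
  refine ⟨?_, lev_cubeFam_le_succ z.1⟩
  rw [geoCK_len]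
  have h : (blkCubeY i c z).1.1 = levCubeY i c z := (B6Geom246MultiLevelBoxL0.lev_eq_of_blkOf_eq (cubeFamY i c).toDomains rfl).symm
  rw [h]

/-! ## §2  The distance axioms (binders `hdnn`, `htri`, `hrefl`, `hsym` of `thm34_Gp_uniform`) -/

/-- `0 ≤ d`, (2.54), `d(y,y) = 0`, symmetry — for the cube sequence's torus graph distance (N03's `triangle_refl_nonneg_T`, `SimpleGraph.dist_comm`).
[cite: Balaban1984PropagatorsII, (2.46) p.231, (2.54) p.233] -/
theorem geoCK_dist_axioms (Rr : ℝ) (H : Prop) :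
    (∀ a a' : (geoCK i c).Site, 0 ≤ (geoCK i c).dist a a') ∧ Triangle254 (toB6 (geoCK i c) Rr H) ∧
    (∀ y : (geoCK i c).Site, (geoCK i c).dist y y = 0) ∧ (∀ y y' : (geoCK i c).Site, (geoCK i c).dist y y' = (geoCK i c).dist y' y) := by
  obtain ⟨htri, hrefl, hnn⟩ := triangle_refl_nonneg_T (cubeFamY i c) (toKT i).hMh (toKT i).hP
  refine ⟨hnn, fun a b e => htri a b e, hrefl, fun y y' => ?_⟩
  show (((bondT (cubeFamY i c)).dist y y' : ℕ) : ℝ) = (((bondT (cubeFamY i c)).dist y' y : ℕ) : ℝ)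
  rw [SimpleGraph.dist_comm]

end Geo

/-! ## §3  [4] (2.60) for the cube sequence and the six p. 398 scale transfers (binder `hST` of `thm34_Gp_uniform`) -/

section Transfer

variable (i : KIdx d ℓ hd hL b₀ b₁) (c : ↥(cubes (toKT i).D.toDomains))

/-- the level-band width `R·M − 1 = R·L·M_h − 1` of the member (the tree's walk form of (2.2) loses one bond per band), as a real.
[cite: Balaban1984PropagatorsII, (2.2) p.224, (2.60) p.234] -/
def RM1 : ℝ := (((toKT i).R * ((ℓ + 1) * (toKT i).Mh) - 1 : ℕ) : ℝ)

/-- `0 ≤ R·M − 1`. [cite: Balaban1984PropagatorsII, (2.2) p.224, bookkeeping] -/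
theorem RM1_nonneg : 0 ≤ RM1 i := Nat.cast_nonneg _

/-- ★ **[4] (2.60) IN GEOMETRIC FORM FOR THE CUBE SEQUENCE**: `(R·M − 1)·max(|n(s) − n(t)| − 1, 0) ≤ d(s, t)` — N03's walk form of (2.2) for the cube
family (`levelGapT (cubeFamY i □)`: r05 certified (2.2) in the torus distance as a structure field) and `levelGap_dist_real`.
[cite: Balaban1984PropagatorsII, Lemma 2.1 (2.60) p.234, (2.57) p.233, (2.2) p.224; Balaban1985BackgroundPropagators, p.408 («This sequence satisfies the conditions (2.1), (2.2)»)] -/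
theorem levelGap_geoCK (s t : BlkCubeY i c) :
    RM1 i * max (|((geoCK i c).scale s : ℝ) - ((geoCK i c).scale t : ℝ)| - 1) 0 ≤ (geoCK i c).dist s t :=
  B6Geometry.levelGap_dist_real (connectedT (D := cubeFamY i c) (toKT i).hMh (toKT i).hP) (levelGapT (cubeFamY i c)) s t

/-- (2.60) in exponential form at every rate `ε ≥ 0`. [cite: Balaban1984PropagatorsII, Lemma 2.1 (2.60) p.234] -/
theorem ineq260_geoCK {ε : ℝ} (hε : 0 ≤ ε) (s t : BlkCubeY i c) :
    Real.exp (-(ε * (geoCK i c).dist s t)) ≤ Real.exp (-(ε * RM1 i * 1 * max (|((geoCK i c).scale s : ℝ) - ((geoCK i c).scale t : ℝ)| - 1) 0)) := by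
  rw [Real.exp_le_exp, neg_le_neg_iff, mul_one]
  calc ε * RM1 i * max (|((geoCK i c).scale s : ℝ) - ((geoCK i c).scale t : ℝ)| - 1) 0
      = ε * (RM1 i * max (|((geoCK i c).scale s : ℝ) - ((geoCK i c).scale t : ℝ)| - 1) 0) := by ring
    _ ≤ ε * (geoCK i c).dist s t := mul_le_mul_of_nonneg_left (levelGap_geoCK i c s t) hε

/-- (2.60) ⇒ `TransferL` at rate `ε > 0` and real power `q` under the size condition `|q|·log L ≤ ε(RM − 1)` (`B6Cor28.transfer_of_260`).
[cite: Balaban1984PropagatorsII, Lemma 2.1 (2.60) p.234 with (2.88) p.238] -/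
theorem transferL_geoCK {ε : ℝ} (hε : 0 < ε) (q : ℝ) (hM : |q| * Real.log (geoCK i c).L ≤ ε * RM1 i) :
    TransferL (geoCK i c).len (geoCK i c).dist ε q ((geoCK i c).L ^ |q|) := by
  have hL1 := geoCK_one_le_L i c
  have hL0 : 0 < (geoCK i c).L := lt_of_lt_of_le one_pos hL1
  have hlarge : (geoCK i c).L ^ |q| ≤ Real.exp (ε * RM1 i * 1) := by
    rw [Real.rpow_def_of_pos hL0, mul_one]
    exact Real.exp_le_exp.mpr ((mul_comm (Real.log (geoCK i c).L) |q|).le.trans hM)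
  have h := (transfer_of_260 (geoCK i c).scale (geoCK i c).dist (geoCK i c).L (geoCK i c).eta ε (RM1 i) 1 q hL1 (geoCK_eta_pos i c)
    hlarge (fun s t => ineq260_geoCK i c hε.le s t)).2
  have e : (fun y => (geoCK i c).L ^ ((geoCK i c).scale y : ℝ) * (geoCK i c).eta) = (geoCK i c).len := by
    funext y; rw [Real.rpow_natCast]; rfl
  rwa [e] at h

/-- ★ **p. 398's SCALE TRANSFER FOR THE CUBE SEQUENCE, EVERY REAL POWER**: `e^{−αδd(s,t)}(L^{n(t)}η)^q ≤ L^{|q|}(L^{n(s)}η)^q` under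
`|q|·log L ≤ αδ(RM − 1)`. [cite: Balaban1985BackgroundPropagators, p.398 remark after (3.47); Balaban1984PropagatorsII, Lemma 2.1 (2.60) p.234] -/
theorem scaleTransfer_rpow_geoCK {δ α : ℝ} (hε : 0 < α * δ) (q : ℝ) (hM : |q| * Real.log (geoCK i c).L ≤ α * δ * RM1 i) :
    ScaleTransfer (geoCK i c) δ α ((geoCK i c).L ^ |q|) (fun y => (geoCK i c).len y ^ q) := by
  intro y y'
  have h := transferL_geoCK i c hε q hM y y'
  have hE : 0 < Real.exp (α * δ * (geoCK i c).dist y y') := Real.exp_pos _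
  rw [Real.exp_neg, inv_mul_le_iff₀ hE]
  calc (geoCK i c).len y' ^ q ≤ (geoCK i c).L ^ |q| * Real.exp (α * δ * (geoCK i c).dist y y') * (geoCK i c).len y ^ q := h
    _ = Real.exp (α * δ * (geoCK i c).dist y y') * ((geoCK i c).L ^ |q| * (geoCK i c).len y ^ q) := by ring

/-- … on the rate window `κlo ≤ αδ` with the ONE constant `(ℓ + 1)⁴` for `|q| ≤ 4`, under `4·log(ℓ+1)/κlo ≤ RM − 1`.
[cite: Balaban1985BackgroundPropagators, p.398 remark after (3.47); Balaban1984PropagatorsII, Lemma 2.1 (2.60) p.234] -/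
theorem scaleTransfer_rpow_window_geoCK {κlo : ℝ} (hκlo : 0 < κlo) {q : ℝ} (hq : |q| ≤ 4) {δ α : ℝ} (hκ : κlo ≤ α * δ)
    (hM : 4 * Real.log ((ℓ : ℝ) + 1) / κlo ≤ RM1 i) :
    ScaleTransfer (geoCK i c) δ α (((ℓ : ℝ) + 1) ^ 4) (fun y => (geoCK i c).len y ^ q) := by
  have hε : 0 < α * δ := lt_of_lt_of_le hκlo hκ
  have hLeq := geoCK_L i c
  have hL1 := geoCK_one_le_L i c
  have hlog0 : 0 ≤ Real.log ((ℓ : ℝ) + 1) := Real.log_nonneg (by rw [← hLeq]; exact hL1)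
  have hRM := RM1_nonneg i
  have h4 : 4 * Real.log ((ℓ : ℝ) + 1) ≤ κlo * RM1 i := by rw [div_le_iff₀ hκlo] at hM; linarith
  have hsize : |q| * Real.log (geoCK i c).L ≤ α * δ * RM1 i := by
    rw [hLeq]
    calc |q| * Real.log ((ℓ : ℝ) + 1) ≤ 4 * Real.log ((ℓ : ℝ) + 1) := mul_le_mul_of_nonneg_right hq hlog0
      _ ≤ κlo * RM1 i := h4
      _ ≤ α * δ * RM1 i := mul_le_mul_of_nonneg_right hκ hRM
  have hT := scaleTransfer_rpow_geoCK i c hε q hsize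
  have hC : (geoCK i c).L ^ |q| ≤ ((ℓ : ℝ) + 1) ^ 4 := by
    rw [hLeq, show ((ℓ : ℝ) + 1) ^ 4 = ((ℓ : ℝ) + 1) ^ ((4 : ℕ) : ℝ) by rw [Real.rpow_natCast]]
    exact Real.rpow_le_rpow_of_exponent_le (by linarith [(Nat.cast_nonneg ℓ : (0 : ℝ) ≤ ℓ)]) (by norm_num; exact hq)
  intro y y'
  refine (hT y y').trans (mul_le_mul_of_nonneg_right hC (Real.rpow_nonneg (geoCK_len_pos i c y).le _))

/-- ★★ **THE BINDER `hST` OF `thm34_Gp_uniform` FOR THE CUBE SEQUENCE** at the rate `δ₀` with `Λ(α) := (ℓ+1)⁴`: the six scale transfers for the weights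
`Lⁿη, (Lⁿη)², (Lⁿη)⁻¹, (Lⁿη)⁻², (Lⁿη)⁻⁴, (Lⁿη)^{−4}` at every exponent `9/5000 ≤ α`, for every member with `4·log(ℓ+1)/((9/5000)δ₀) ≤ RM − 1`.
[cite: Balaban1985BackgroundPropagators, p.398 remark after (3.47), Thm 3.4 p.400; Balaban1984PropagatorsII, Lemma 2.1 (2.60) p.234] -/
theorem hST_geoCK {δ₀ : ℝ} (hδ₀ : 0 < δ₀) (hM : 4 * Real.log ((ℓ : ℝ) + 1) / (9 / 5000 * δ₀) ≤ RM1 i) :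
    ∀ α : ℝ, 9 / 5000 ≤ α →
      ScaleTransfer (geoCK i c) δ₀ α (((ℓ : ℝ) + 1) ^ 4) (fun a => (geoCK i c).len a) ∧
      ScaleTransfer (geoCK i c) δ₀ α (((ℓ : ℝ) + 1) ^ 4) (fun a => (geoCK i c).len a ^ 2) ∧
      ScaleTransfer (geoCK i c) δ₀ α (((ℓ : ℝ) + 1) ^ 4) (fun a => ((geoCK i c).len a)⁻¹) ∧
      ScaleTransfer (geoCK i c) δ₀ α (((ℓ : ℝ) + 1) ^ 4) (fun a => ((geoCK i c).len a ^ 2)⁻¹) ∧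
      ScaleTransfer (geoCK i c) δ₀ α (((ℓ : ℝ) + 1) ^ 4) (fun a => ((geoCK i c).len a ^ 4)⁻¹) ∧
      ScaleTransfer (geoCK i c) δ₀ α (((ℓ : ℝ) + 1) ^ 4) (fun y => (geoCK i c).len y ^ (-(4 : ℝ))) := by
  intro α hα
  have hκlo : 0 < 9 / 5000 * δ₀ := by positivity
  have hκ : 9 / 5000 * δ₀ ≤ α * δ₀ := mul_le_mul_of_nonneg_right hα hδ₀.le
  have hpos : ∀ y, 0 < (geoCK i c).len y := geoCK_len_pos i c
  have T : ∀ q : ℝ, |q| ≤ 4 → ScaleTransfer (geoCK i c) δ₀ α (((ℓ : ℝ) + 1) ^ 4) (fun y => (geoCK i c).len y ^ q) :=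
    fun q hq => scaleTransfer_rpow_window_geoCK i c hκlo hq hκ hM
  refine ⟨?_, ?_, ?_, ?_, ?_, T (-4) (by norm_num)⟩
  · exact scaleTransfer_congr (fun y => Real.rpow_one _) (T 1 (by norm_num))
  · exact scaleTransfer_congr (fun y => by rw [← Real.rpow_natCast]; norm_num) (T 2 (by norm_num))
  · exact scaleTransfer_congr (fun y => Real.rpow_neg_one _) (T (-1) (by norm_num))
  · exact scaleTransfer_congr (fun y => by
      rw [Real.rpow_neg (hpos y).le, ← Real.rpow_natCast]; norm_num) (T (-2) (by norm_num))
  · exact scaleTransfer_congr (fun y => by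
      rw [Real.rpow_neg (hpos y).le, ← Real.rpow_natCast]; norm_num) (T (-4) (by norm_num))

end Transfer

/-! ## §4  [4] Lemma 2.1 (2.61) for the cube sequence at every exponent `9/5000 ≤ α < 1` (binder `h261` of `thm34_Gp_uniform`) -/

section RowSum

/-- the threshold count `N₁(σ) = ⌈(2(d+1) + 1)L/σ⌉ + 1` of r05's `rowSum_and_thresholdT` (window `n = 0`). [cite: Balaban1984PropagatorsII, (2.59) p.233, dictionary] -/
def N1 (d ℓ : ℕ) (σ : ℝ) : ℕ := ⌈(2 * ((d : ℝ) + 1) + ((0 : ℕ) : ℝ) + 1) * ((ℓ : ℝ) + 1) / σ⌉₊ + 1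

variable (i : KIdx d ℓ hd hL b₀ b₁) (c : ↥(cubes (toKT i).D.toDomains))

/-- ★ **(2.61) WITH r05's DEFINITE CONSTANT, AT EVERY RATE `τ ≥ σ`, FOR THE CUBE SEQUENCE** above the threshold `N₁(σ) + 1 ≤ R·L·M_h`
(`B8Ineq198MultiLevelTorusL0.rowSum_and_thresholdT (D := cubeFamY i □)`). [cite: Balaban1984PropagatorsII, Lemma 2.1 (2.61) p.234, (2.59) p.233] -/
theorem rowSum_geoCK {σ : ℝ} (hσ : 0 < σ) (hRM : N1 d ℓ σ + 1 ≤ (toKT i).R * ((ℓ + 1) * (toKT i).Mh)) :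
    ∀ τ : ℝ, σ ≤ τ → ∀ y : (geoCK i c).Site,
      ∑ y' : (geoCK i c).Site, Real.exp (-(τ * (geoCK i c).dist y y')) ≤ K261 (N1 d ℓ σ) (d + 1) ((ℓ : ℝ) + 1) 1 (1 * σ) :=
  (rowSum_and_thresholdT (D := cubeFamY i c) (toKT i).hMh (toKT i).hP hσ 0 (N₁ := N1 d ℓ σ) rfl hRM).1

/-- ★★ **THE BINDER `h261` OF `thm34_Gp_uniform` FOR THE CUBE SEQUENCE**: for every rate `δ₀ > 0` there is ONE exponent `dB` (a function of `d, ℓ, δ₀`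
only — the door exponent making `c₁(dB, δ₀, α)` exceed r05's constant on the whole window) such that every member with `N₁((9/5000)δ₀) + 1 ≤ R·L·M_h`
and every cover cube satisfy `Ineq261 dB (toB6 (geoCK i □) Rr H) δ₀ α` for all `9/5000 ≤ α ≤ 1` (any transport letters `Rr`, `H`).
[cite: Balaban1984PropagatorsII, Lemma 2.1 (2.61) p.234 + (2.59) p.233; Balaban1985BackgroundPropagators, Thm 3.4 p.400] -/
theorem exists_h261_geoCK (d ℓ : ℕ) {δ₀ : ℝ} (hδ₀ : 0 < δ₀) :
    ∃ dB : ℕ, ∀ {hd : 1 ≤ d + 1} {hL : Odd (ℓ + 1) ∧ 1 < ℓ + 1} {b₀ b₁ : ℝ} (i : KIdx d ℓ hd hL b₀ b₁) (c : ↥(cubes (toKT i).D.toDomains))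
      (Rr : ℝ) (H : Prop), N1 d ℓ (9 / 5000 * δ₀) + 1 ≤ (toKT i).R * ((ℓ + 1) * (toKT i).Mh) →
      ∀ α : ℝ, 9 / 5000 ≤ α → α ≤ 1 → Ineq261 dB (toB6 (geoCK i c) Rr H) δ₀ α := by
  have hσ : 0 < 9 / 5000 * δ₀ := by positivity
  obtain ⟨dB, hdB⟩ := exists_exp_window (K261 (N1 d ℓ (9 / 5000 * δ₀)) (d + 1) ((ℓ : ℝ) + 1) 1 (1 * (9 / 5000 * δ₀))) hδ₀
  refine ⟨dB, fun i c Rr H hRM α hα hα1 => ?_⟩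
  have hα0 : 0 < α := lt_of_lt_of_le (by norm_num) hα
  refine B6RandomWalkHom.ineq261_of_rowSum_le (g := toB6 (geoCK i c) Rr H) dB δ₀ α _ (fun y => ?_) (hdB δ₀ α hδ₀ le_rfl hα0 hα1)
  exact rowSum_geoCK i c hσ hRM (α * δ₀) (mul_le_mul_of_nonneg_right hα hδ₀.le) y

end RowSum

/-! ## §5  The stencil of one lattice step (binders `hd₀B`, `hd₀F`, `hd₀0` of `thm34_Gp_uniform`, `d₀ = 1`) -/

section Stencil

variable (i : KIdx d ℓ hd hL b₀ b₁) (c : ↥(cubes (toKT i).D.toDomains))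

/-- one torus translation by `±e_μ` has torus length `≤ 1`. [cite: Balaban1984PropagatorsII, (2.46) p.231, bookkeeping] -/
theorem torusSupNorm_sub_tshift_unit_le_one (z : SiteY i) (μ : Fin (d + 1)) (sgn : ℤ) (hs : sgn = 1 ∨ sgn = -1) :
    torusSupNorm (toKT i).NB (z.1 - (tshift (toKT i).NB (sgn • unitVec μ) z).1) ≤ 1 := by
  have hN : ∀ ν, 1 ≤ (toKT i).NB ν := one_le_of_mem z.2
  obtain ⟨m, hm⟩ := tshift_val_eq_translate (toKT i).NB (sgn • unitVec μ) z
  unfold torusSupNorm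
  refine Finset.sup'_le _ _ fun ν _ => ?_
  have e : (z.1 - (tshift (toKT i).NB (sgn • unitVec μ) z).1) ν = -((sgn • unitVec μ) ν) + (toKT i).NB ν * (-m ν) := by
    rw [hm]; simp only [B4TorusKernel.MultiPeriod.translate, Pi.sub_apply, Pi.add_apply]; ring
  rw [e, circAbs_add_mul]
  have h1 : circAbs ((toKT i).NB ν) (-((sgn • unitVec μ) ν)) ≤ |(-((sgn • unitVec μ) ν))| := circAbs_le_abs (hN ν) _
  have h2 : |(-((sgn • unitVec μ) ν))| ≤ 1 := by
    simp only [unitVec, Pi.smul_apply, Pi.single_apply, smul_eq_mul, abs_neg]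
    split_ifs <;> rcases hs with h | h <;> simp [h]
  exact_mod_cast h1.trans h2

/-- blocks of sites at torus distance `≤ 1` are at graph distance `≤ 1` (they touch). [cite: Balaban1984PropagatorsII, (2.46) p.231] -/
theorem dist_blkCubeY_le_one_of_near {z w : SiteY i} (h : torusSupNorm (toKT i).NB (z.1 - w.1) ≤ 1) :
    (geoCK i c).dist (blkCubeY i c z) (blkCubeY i c w) ≤ 1 := by
  rw [geoCK_dist]
  by_cases hst : blkCubeY i c z = blkCubeY i c w
  · rw [hst, SimpleGraph.dist_self]; norm_num
  · have hadj : (bondT (cubeFamY i c)).Adj (blkCubeY i c z) (blkCubeY i c w) :=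
      (bondT_adj (D := cubeFamY i c)).2 ⟨hst, z, w, rfl, rfl, h⟩
    rw [SimpleGraph.dist_eq_one_iff_adj.2 hadj]; norm_num

/-- ★ **THE STENCIL BINDERS `hd₀F`, `hd₀B`, `hd₀0` WITH `d₀ = 1`**: the blocks of `z` and `z ± e_μ` are at graph distance `≤ 1`, and `d(y, y) ≤ 1`.
[cite: Balaban1985BackgroundPropagators, Thm 3.4 p.400 (stencil of V′), (3.60) p.402; Balaban1984PropagatorsII, (2.46) p.231] -/
theorem stencil_geoCK :
    (∀ (μ : Fin (d + 1)) (z : SiteY i), (geoCK i c).dist (blkCubeY i c z) (blkCubeY i c ((shiftY i μ).symm z)) ≤ 1) ∧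
    (∀ (μ : Fin (d + 1)) (z : SiteY i), (geoCK i c).dist (blkCubeY i c z) (blkCubeY i c (shiftY i μ z)) ≤ 1) ∧
    (∀ y : (geoCK i c).Site, (geoCK i c).dist y y ≤ 1) := by
  refine ⟨fun μ z => dist_blkCubeY_le_one_of_near i c ?_, fun μ z => dist_blkCubeY_le_one_of_near i c ?_, fun y => ?_⟩
  · have e : (shiftY i μ).symm z = tshift (toKT i).NB ((-1 : ℤ) • unitVec μ) z := by rw [neg_one_smul]; exact tshift_symm_apply _ _ _
    rw [e]; exact torusSupNorm_sub_tshift_unit_le_one i z μ (-1) (Or.inr rfl)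
  · have e : shiftY i μ z = tshift (toKT i).NB ((1 : ℤ) • unitVec μ) z := by rw [one_smul]; rfl
    rw [e]; exact torusSupNorm_sub_tshift_unit_le_one i z μ 1 (Or.inl rfl)
  · rw [geoCK_dist, SimpleGraph.dist_self]; norm_num

end Stencil

/-! ## §6  The instance-level binders of `thm34_Gp_uniform` at `g := geoCK i □`: the sites are a nonempty finite type with decidable equality -/

section Instances

variable (i : KIdx d ℓ hd hL b₀ b₁) (c : ↥(cubes (toKT i).D.toDomains))

/-- the origin of the torus box is a site. [cite: Balaban1984PropagatorsII, (2.1) p.224, bookkeeping] -/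
def originY : SiteY i :=
  ⟨fun _ => 0, by
    rw [B4Reflection242.mem_boxDom]
    intro μ
    have h := B6MultiLevelTorusOperator.one_le_N0 (ℓ := ℓ) (k := (toKT i).k) (toKT i).hMh (toKT i).hP μ
    exact ⟨le_rfl, by exact_mod_cast h⟩⟩

/-- the cube sequence has a block (binder `[Nonempty g.Site]`). [cite: Balaban1985BackgroundPropagators, p.408, bookkeeping] -/
theorem geoCK_site_nonempty : Nonempty (geoCK i c).Site := ⟨blkCubeY i c (originY i)⟩

/-- the binders `[Fintype g.Site]`, `[DecidableEq g.Site]` are found by instance search at `g := geoCK i □` (the sites are a subtype of a finite set).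
[cite: Balaban1985BackgroundPropagators, p.397 («𝔅»), bookkeeping] -/
example : Fintype (geoCK i c).Site := inferInstance

example : DecidableEq (geoCK i c).Site := inferInstance

end Instances

end Literature.MathematicalPhysics.QuantumFieldTheory.Balaban1983to89.B9CubeGeometryInputs

end
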